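import Literature.Analysis.FluidPDE.Tao2016AveragedNS.SplitCascadeRescaledModes
import HarnessLib

/-!
# The split Prop. 6.5: the energy inequality of the asymmetry triple at one scale (rotor-neutral form)

T. Tao, *Finite time blowup for an averaged three-dimensional Navier–Stokes equation*,
J. Amer. Math. Soc. 29 (2016), 601–674 = arXiv:1402.0290v3, §5.5 (the conservative rotor
`ε⁻²(c Z_d - d Z_c)`-type couplings), §6.4 Prop. 6.5.
HONEST FRAMING: statements about the SPLIT cascade model system; nothing here proves the split
Prop. 6.5 and nothing here concerns the true Navier–Stokes equations.

From the rows (6.Z1)–(6.Z3) of `RescaledSplitHypotheses` at a scale `k`,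
`∂Z̃_a = Λ_k(εb̃Z̃_a + ε²e^{-K¹⁰}c̃Z̃_a - ε⁻²c̃Z̃_d + ε⁻²d̃Z̃_c) + e_a`, `∂Z̃_c = -Λ_kε⁻¹K¹⁰b̃Z̃_c + e_c`,
`∂Z̃_d = Λ_k(ε⁻²c̃Z̃_a - ε⁻²ãZ̃_c + (1+ε₀)^{5/2}Kã_{k+1}Z̃_d) + e_d`, `|e_i| ≤ E = C₁(1+ε₀)^{2k-n₀/2}Ẽ_k^{1/2}`:
the rotor terms `∓Λ_kε⁻²c̃ Z̃_aZ̃_d` CANCEL in `Σ_i Z̃_i ∂Z̃_i`, leaving the energy inequality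
`Σ_i Z̃_i∂Z̃_i ≤ β_k(t) Σ_i Z̃_i² + √3·E·(Σ_i Z̃_i²)^{1/2}` with the rate
`β_k = Λ_k(ε|b̃| + ε²e^{-K¹⁰}|c̃| + ε⁻²(|ã| + |d̃|) + ε⁻¹K¹⁰|b̃| + (1+ε₀)^{5/2}K|ã_{k+1}|)` — NO `ε⁻²|c̃|`
term. This is the input of the Euclidean-norm Grönwall lemma
(`Literature/Analysis/ODE/VectorLinearComparison.lean`) for the whole-past smallness of the
asymmetries of the fresh and dormant shells, where `β_k` is integrable over the past because every
coefficient is a mode of a shell whose energy decays geometrically into the past.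

## References

* T. Tao, arXiv:1402.0290v3, §5.5, §6.4 Prop. 6.5. [`Tao2016AveragedNS`]
-/

noncomputable section

open Set

namespace Literature.Analysis.FluidPDE

namespace Tao2016AveragedNS

section AsymEnergy

variable {γ ε₀ K ε C₁ C₂ C₃ : ℝ} {n₀ N : ℤ} {ηp : ℤ → ℝ} {βp : ℕ → ℝ} {τ : ℤ → ℝ}
  {Y : Fin 4 → ℤ → ℝ → ℝ} {W : Fin 3 → ℤ → ℝ → ℝ} {F : ℤ → ℝ → ℝ}

/-- `|x| + |y| + |z| ≤ √3 · √(x² + y² + z²)` (Cauchy–Schwarz in `ℝ³`). [cite: Tao2016AveragedNS, §5.5] -/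
theorem abs_add_abs_add_abs_le_sqrt_three (x y z : ℝ) :
    |x| + |y| + |z| ≤ Real.sqrt 3 * Real.sqrt (x ^ 2 + y ^ 2 + z ^ 2) := by
  rw [← Real.sqrt_mul (by norm_num : (0 : ℝ) ≤ 3)]
  apply Real.le_sqrt_of_sq_le
  have hx := sq_abs x; have hy := sq_abs y; have hz := sq_abs z
  nlinarith [sq_nonneg (|x| - |y|), sq_nonneg (|y| - |z|), sq_nonneg (|x| - |z|),
    abs_nonneg x, abs_nonneg y, abs_nonneg z]

/-- **The energy inequality of the asymmetry triple at scale `k` (rotor-neutral form).** For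
`t ≥ τ₀` and `ε > 0`:
`Σ_i Z̃_{i,k}∂Z̃_{i,k} ≤ β_k(t)·Σ_i Z̃_{i,k}² + √3·C₁(1+ε₀)^{2k-n₀/2}Ẽ_k^{1/2}·(Σ_i Z̃_{i,k}²)^{1/2}`
with `β_k(t) = (1+ε₀)^{5k/2}(ε|b̃_k| + ε²e^{-K¹⁰}|c̃_k| + ε⁻²(|ã_k| + |d̃_k|) + ε⁻¹K¹⁰|b̃_k| +
(1+ε₀)^{5/2}K|ã_{k+1}|)`. [cite: Tao2016AveragedNS, §5.5, §6.4 Prop. 6.5] -/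
theorem RescaledSplitHypotheses.asym_energy_ineq
    (h : RescaledSplitHypotheses γ ε₀ K ε C₁ C₂ C₃ n₀ N ηp βp τ Y W F) (hε₀ : -1 < ε₀)
    (hε : 0 < ε) (hK : 0 ≤ K) (k : ℤ) {t : ℝ} (ht : τ (n₀ - N) ≤ t) :
    ∑ i, W i k t * derivWithin (W i k) (Ici (τ (n₀ - N))) t ≤
      (1 + ε₀) ^ ((5 : ℝ) * k / 2) * (ε * |Y 1 k t| + ε ^ 2 * Real.exp (-K ^ 10) * |Y 2 k t| +
          (ε ^ 2)⁻¹ * (|Y 0 k t| + |Y 3 k t|) + ε⁻¹ * K ^ 10 * |Y 1 k t| +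
          (1 + ε₀) ^ ((5 : ℝ) / 2) * K * |Y 0 (k + 1) t|) * ∑ i, W i k t ^ 2 +
        Real.sqrt 3 * (C₁ * (1 + ε₀) ^ ((2 : ℝ) * k - n₀ / 2) * Real.sqrt (F k t)) *
          Real.sqrt (∑ i, W i k t ^ 2) := by
  have hq0 : (0 : ℝ) < 1 + ε₀ := by linarith
  set Λ : ℝ := (1 + ε₀) ^ ((5 : ℝ) * k / 2) with hΛ
  have hΛ0 : 0 ≤ Λ := (Real.rpow_pos_of_pos hq0 _).le
  set Q : ℝ := (1 + ε₀) ^ ((5 : ℝ) / 2) with hQ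
  have hQ0 : 0 ≤ Q := (Real.rpow_pos_of_pos hq0 _).le
  set E : ℝ := C₁ * (1 + ε₀) ^ ((2 : ℝ) * k - n₀ / 2) * Real.sqrt (F k t) with hE
  -- abbreviations for the modes and asymmetries at time `t`
  set a := Y 0 k t with ha
  set b := Y 1 k t with hb
  set c := Y 2 k t with hc
  set d := Y 3 k t with hd
  set a' := Y 0 (k + 1) t with ha'
  set za := W 0 k t with hza
  set zc := W 1 k t with hzc
  set zd := W 2 k t with hzd
  -- the three rows, as `∂Z̃_i = L_i + e_i`, `|e_i| ≤ E`
  set La : ℝ := Λ * (ε * b * za + ε ^ 2 * Real.exp (-K ^ 10) * c * za - (ε ^ 2)⁻¹ * c * zd +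
    (ε ^ 2)⁻¹ * d * zc) with hLa
  set Lc : ℝ := Λ * (-(ε⁻¹ * K ^ 10 * b * zc)) with hLc
  set Ld : ℝ := Λ * ((ε ^ 2)⁻¹ * c * za - (ε ^ 2)⁻¹ * a * zc + Q * K * a' * zd) with hLd
  set Da := derivWithin (W 0 k) (Ici (τ (n₀ - N))) t with hDa
  set Dc := derivWithin (W 1 k) (Ici (τ (n₀ - N))) t with hDc
  set Dd := derivWithin (W 2 k) (Ici (τ (n₀ - N))) t with hDd
  have e1 : |Da - La| ≤ E := h.eqZ1 k t ht
  have e2 : |Dc - Lc| ≤ E := h.eqZ2 k t ht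
  have e3 : |Dd - Ld| ≤ E := h.eqZ3 k t ht
  have hE0 : 0 ≤ E := (abs_nonneg _).trans e1
  -- the sums as `Fin 3` sums
  have hsumD : ∑ i, W i k t * derivWithin (W i k) (Ici (τ (n₀ - N))) t =
      za * Da + zc * Dc + zd * Dd := by
    rw [Fin.sum_univ_three]
  have hsumS : ∑ i, W i k t ^ 2 = za ^ 2 + zc ^ 2 + zd ^ 2 := by rw [Fin.sum_univ_three]
  rw [hsumD, hsumS]
  set S : ℝ := za ^ 2 + zc ^ 2 + zd ^ 2 with hS
  have hS0 : 0 ≤ S := by positivity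
  have hza2 := sq_nonneg za
  have hzc2 := sq_nonneg zc
  have hzd2 := sq_nonneg zd
  have hzaS : za ^ 2 ≤ S := by rw [hS]; linarith
  have hzcS : zc ^ 2 ≤ S := by rw [hS]; linarith
  have hzdS : zd ^ 2 ≤ S := by rw [hS]; linarith
  have hac : |za| * |zc| ≤ S := by
    have h2 := two_mul_le_add_sq |za| |zc|
    rw [sq_abs, sq_abs] at h2
    have hp : 0 ≤ |za| * |zc| := mul_nonneg (abs_nonneg _) (abs_nonneg _)
    rw [hS]; linarith
  have hcd : |zc| * |zd| ≤ S := by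
    have h2 := two_mul_le_add_sq |zc| |zd|
    rw [sq_abs, sq_abs] at h2
    have hp : 0 ≤ |zc| * |zd| := mul_nonneg (abs_nonneg _) (abs_nonneg _)
    rw [hS]; linarith
  -- the linear part: rotor-neutral identity and bound
  have hlin : za * La + zc * Lc + zd * Ld =
      Λ * ((ε * b + ε ^ 2 * Real.exp (-K ^ 10) * c) * za ^ 2 + (ε ^ 2)⁻¹ * d * (za * zc) -
        ε⁻¹ * K ^ 10 * b * zc ^ 2 - (ε ^ 2)⁻¹ * a * (zc * zd) + Q * K * a' * zd ^ 2) := by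
    simp only [hLa, hLc, hLd]; ring
  have hex : 0 < Real.exp (-K ^ 10) := Real.exp_pos _
  have hε2 : 0 ≤ (ε ^ 2)⁻¹ := by positivity
  have hεK : 0 ≤ ε⁻¹ * K ^ 10 := by positivity
  have T1 : (ε * b + ε ^ 2 * Real.exp (-K ^ 10) * c) * za ^ 2 ≤
      (ε * |b| + ε ^ 2 * Real.exp (-K ^ 10) * |c|) * S := by
    have hcoef : ε * b + ε ^ 2 * Real.exp (-K ^ 10) * c ≤ ε * |b| + ε ^ 2 * Real.exp (-K ^ 10) * |c| :=
      add_le_add (mul_le_mul_of_nonneg_left (le_abs_self b) hε.le)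
        (mul_le_mul_of_nonneg_left (le_abs_self c) (by positivity))
    have hcoef0 : 0 ≤ ε * |b| + ε ^ 2 * Real.exp (-K ^ 10) * |c| := by positivity
    calc (ε * b + ε ^ 2 * Real.exp (-K ^ 10) * c) * za ^ 2
        ≤ (ε * |b| + ε ^ 2 * Real.exp (-K ^ 10) * |c|) * za ^ 2 :=
          mul_le_mul_of_nonneg_right hcoef (sq_nonneg _)
      _ ≤ (ε * |b| + ε ^ 2 * Real.exp (-K ^ 10) * |c|) * S := mul_le_mul_of_nonneg_left hzaS hcoef0
  have T2 : (ε ^ 2)⁻¹ * d * (za * zc) ≤ (ε ^ 2)⁻¹ * |d| * S := by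
    have h' : d * (za * zc) ≤ |d| * S :=
      calc d * (za * zc) ≤ |d * (za * zc)| := le_abs_self _
        _ = |d| * (|za| * |zc|) := by rw [abs_mul, abs_mul]
        _ ≤ |d| * S := mul_le_mul_of_nonneg_left hac (abs_nonneg _)
    have := mul_le_mul_of_nonneg_left h' hε2
    linarith [this]
  have T3 : -(ε⁻¹ * K ^ 10 * b * zc ^ 2) ≤ ε⁻¹ * K ^ 10 * |b| * S := by
    have h' : -(b * zc ^ 2) ≤ |b| * S :=
      calc -(b * zc ^ 2) ≤ |b * zc ^ 2| := neg_le_abs _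
        _ = |b| * zc ^ 2 := by rw [abs_mul, abs_of_nonneg hzc2]
        _ ≤ |b| * S := mul_le_mul_of_nonneg_left hzcS (abs_nonneg _)
    have := mul_le_mul_of_nonneg_left h' hεK
    linarith [this]
  have T4 : -((ε ^ 2)⁻¹ * a * (zc * zd)) ≤ (ε ^ 2)⁻¹ * |a| * S := by
    have h' : -(a * (zc * zd)) ≤ |a| * S :=
      calc -(a * (zc * zd)) ≤ |a * (zc * zd)| := neg_le_abs _
        _ = |a| * (|zc| * |zd|) := by rw [abs_mul, abs_mul]
        _ ≤ |a| * S := mul_le_mul_of_nonneg_left hcd (abs_nonneg _)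
    have := mul_le_mul_of_nonneg_left h' hε2
    linarith [this]
  have T5 : Q * K * a' * zd ^ 2 ≤ Q * K * |a'| * S := by
    have hQK : 0 ≤ Q * K := mul_nonneg hQ0 hK
    have h' : a' * zd ^ 2 ≤ |a'| * S :=
      calc a' * zd ^ 2 ≤ |a'| * zd ^ 2 := mul_le_mul_of_nonneg_right (le_abs_self _) (sq_nonneg _)
        _ ≤ |a'| * S := mul_le_mul_of_nonneg_left hzdS (abs_nonneg _)
    have := mul_le_mul_of_nonneg_left h' hQK
    linarith [this]
  have hβ : za * La + zc * Lc + zd * Ld ≤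
      Λ * (ε * |b| + ε ^ 2 * Real.exp (-K ^ 10) * |c| + (ε ^ 2)⁻¹ * (|a| + |d|) +
        ε⁻¹ * K ^ 10 * |b| + Q * K * |a'|) * S := by
    rw [hlin]
    have hin : (ε * b + ε ^ 2 * Real.exp (-K ^ 10) * c) * za ^ 2 + (ε ^ 2)⁻¹ * d * (za * zc) -
        ε⁻¹ * K ^ 10 * b * zc ^ 2 - (ε ^ 2)⁻¹ * a * (zc * zd) + Q * K * a' * zd ^ 2 ≤
        (ε * |b| + ε ^ 2 * Real.exp (-K ^ 10) * |c| + (ε ^ 2)⁻¹ * (|a| + |d|) +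
          ε⁻¹ * K ^ 10 * |b| + Q * K * |a'|) * S := by
      linarith [T1, T2, T3, T4, T5]
    calc _ ≤ Λ * ((ε * |b| + ε ^ 2 * Real.exp (-K ^ 10) * |c| + (ε ^ 2)⁻¹ * (|a| + |d|) +
          ε⁻¹ * K ^ 10 * |b| + Q * K * |a'|) * S) := mul_le_mul_of_nonneg_left hin hΛ0
      _ = _ := by ring
  -- the error part
  have hea : za * (Da - La) ≤ |za| * E :=
    calc za * (Da - La) ≤ |za * (Da - La)| := le_abs_self _
      _ = |za| * |Da - La| := abs_mul _ _
      _ ≤ |za| * E := mul_le_mul_of_nonneg_left e1 (abs_nonneg _)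
  have hec : zc * (Dc - Lc) ≤ |zc| * E :=
    calc zc * (Dc - Lc) ≤ |zc * (Dc - Lc)| := le_abs_self _
      _ = |zc| * |Dc - Lc| := abs_mul _ _
      _ ≤ |zc| * E := mul_le_mul_of_nonneg_left e2 (abs_nonneg _)
  have hed : zd * (Dd - Ld) ≤ |zd| * E :=
    calc zd * (Dd - Ld) ≤ |zd * (Dd - Ld)| := le_abs_self _
      _ = |zd| * |Dd - Ld| := abs_mul _ _
      _ ≤ |zd| * E := mul_le_mul_of_nonneg_left e3 (abs_nonneg _)
  have hcs := abs_add_abs_add_abs_le_sqrt_three za zc zd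
  have herr : (|za| + |zc| + |zd|) * E ≤ Real.sqrt 3 * E * Real.sqrt S := by
    have := mul_le_mul_of_nonneg_right hcs hE0
    rw [hS]; linarith [this]
  have hsplit : za * Da + zc * Dc + zd * Dd =
      (za * La + zc * Lc + zd * Ld) + (za * (Da - La) + zc * (Dc - Lc) + zd * (Dd - Ld)) := by ring
  rw [hsplit]
  have hfin : za * (Da - La) + zc * (Dc - Lc) + zd * (Dd - Ld) ≤ Real.sqrt 3 * E * Real.sqrt S := by
    linarith [hea, hec, hed, herr]
  linarith [hβ, hfin]

end AsymEnergy

end Tao2016AveragedNS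

end Literature.Analysis.FluidPDE
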